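import Literature.MathematicalPhysics.QuantumFieldTheory.Balaban1983to89.B4Eq242TorusMirrorsTiling

/-!
# `Balaban1983to89.B6MultiLevelTorusMirrorBlockTiling` — [Balaban1983RegularityDecay] (2.42) p. 584 at BLOCK level: THE FACE REFLECTIONS OF THE DOUBLED TORUS AS
# PERMUTATIONS OF THE BLOCKS of a reflection-compatible multilevel family ([Balaban1984PropagatorsII] (2.1)–(2.4), (2.45)), THE TILING OF THE FREE BLOCKS BY THE
# IMAGES OF THE BLOCKS INSIDE THE OPEN MIRROR BOX, and THE MIRROR CANCELLATION at every non-image block — the BLOCK-CARRIER hypotheses of the fold engine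
# `B4Eq242SignedImagesFold` (ROAD (I) «IMAGES», file D1‴; towards [Balaban1985BackgroundPropagators] Thm 3.2 (3.48) for the Dirichlet `C_□(1) = (Q′G′_□²Q′*)⁻¹`
# of the cube sequence, p. 409 l. 1–5, a kernel on BLOCKS)

statement-level skeleton of published theorems with citation tags; proofs where landed; nothing here is a claim about the Yang–Mills mass gap

CITATION HEADER (lean-in-tree rule).  [B4] = T. Bałaban, *Regularity and decay of lattice Green's functions*, Commun. Math. Phys. **89** (1983) 571–597
[`Balaban1983RegularityDecay`], (2.42) p. 584.  [4] = T. Bałaban, *Propagators and renormalization transformations for lattice gauge theories. II*, Commun. Math. Phys.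
**96** (1984) 223–250 [`Balaban1984PropagatorsII`], (2.1)–(2.4) p. 224 (the blocks `B^j(y)`), (2.45)–(2.46) p. 231, Prop. 2.3 (2.87)–(2.88) p. 238 (`(Q′G′²Q′*)⁻¹`, a kernel
on 𝔅 × 𝔅).  [B9] = [`Balaban1985BackgroundPropagators`] p. 394 (Dirichlet conventions), Thm 3.2 (3.48) p. 398, p. 409 l. 1–5 («C_□(U) = (Q′(U)G′_□²(U)Q′*(U))⁻¹»).

WHY THIS FILE (cell `pub-ymgap`, node N06, seat dag-n06-c g33; FILES 5a `B4Eq242SignedImagesFold`, 5b-i `B4Eq242TorusMirrorsTiling`).  Print's `C_□(1)` is a kernel on the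
BLOCKS inside `Ω₀(□)`; the fold engine inverts the compression of the block word `Q̂′Ĝ²Q̂′*` of g31's reflected cube family once the BLOCK carrier of the doubled torus
carries (i) an action of the reflection group compatible with the site action (`y^j(σ_ε x) = σ_ε y^j(x)`), (ii) the tiling of the non-fixed blocks by the images of the
blocks INSIDE the open box, (iii) the cancellation of signed image sums at the remaining (mirror) blocks.  g31 proved the compatibility for the reflected family
(`B6MultiLevelTorusMirrorDecay.blkOf_trefl_eq_of_blkOf_eq`) and the margin of the cube's box (`B9CubeSequence408Mirrors.margC`: a block meeting the open box lies in it);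
THIS FILE turns any such pair (compatibility `hblk`, margin `hmarg`) on any multilevel family of the doubled torus into (i)–(iii) in the engine's shape, reducing the
block statements to FILE 5b-i's site statements (a block is an image iff one of its sites is; a non-image block consists of a mirror site's block and is fixed).

WHAT IS PROVED (3 `def`s with bodies — `blkReflFun`, `blkRefl`, `blkInside`; theorems; 0 sorry; 0 new named facts; standard axioms), for a family `F` on the doubled torus with mirror
data `hmir` and block compatibility `hblk`:
* §1 `blkRefl hblk ε : Equiv.Perm (bset F)`, ★`blkRefl_blkOf` (`= y^j ∘ σ_ε`), `blkRefl_xorIdx` (multiplicative), `blkRefl_bot`, `blkRefl_flipAt`, `blkRefl_blkRefl`;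
* §2 `blkInside X`, `mem_blkInside`, `blkOf_mem_blkInside_of_mem` (margin ⇒ the block of an open-box site is inside), ★`blkRefl_not_mem_blkInside` (block FREENESS),
  ★`blkRefl_injOn_inside` (block TILING), ★`exists_single_fixed_block_of_not_image` (a non-image block is fixed by a single mirrored reflection);
* §3 ★`sum_tsign_mul_eq_zero_of_fixed₂` (cancellation at a fixed point, ANY row carrier), ★★`block_cancel`, ★★`block_tiling`, `block_closure`, `blkRefl_flipAt′`
  (the `hmem ∕ hσ ∕ hs ∕ hbij ∕ htile ∕ hcancel ∕ hfree` inputs of `sum_foldK_mul_foldK` ∕ `compress_foldK_mul_compress_foldK_eq_one` for a middle BLOCK carrier).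

HONEST SCOPE / NOT CLAIMED.  Elementary bookkeeping; `hblk` and `hmarg` are hypotheses (discharged for the cube's reflected family by the g31 lemmas named above in
the instance file); no operator, no estimate.  Count-neutral; N06 NOT discharged; nothing on `d = 4`, the continuum, reflection positivity, the mass gap or Clay.  No
`sorry`, no `axiom`, no `instance`, no `notation`.  Seat `pub-ymgap-dag-n06-c` g33, 2026-08-31; `--supports stmt-QuantumFields-27239`.

RELATED IN THE TREE, NOT DUPLICATED: g31 `B6MultiLevelTorusMirrorDecay` (`blkPsi`, `blkOf_trefl_eq_of_blkOf_eq` — the fold map and the compatibility; no permutation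
of blocks, no tiling there), FILE 5b-i (site carrier), FILE 5a (engine).
-/

namespace Literature.MathematicalPhysics.QuantumFieldTheory.Balaban1983to89.B6MultiLevelTorusMirrorBlockTiling

open Finset
open Literature.MathematicalPhysics.QuantumFieldTheory.Balaban1983to89.B4Reflection242 (boxDom mem_boxDom blk)
open Literature.MathematicalPhysics.QuantumFieldTheory.Balaban1983to89.B6MultiLevelBoxOperator (N0)
open Literature.MathematicalPhysics.QuantumFieldTheory.Balaban1983to89.B6MultiLevelTorusOperatorL0 (TDomains)
open Literature.MathematicalPhysics.QuantumFieldTheory.Balaban1983to89.B6Geom246MultiLevelBoxL0 (bset blkOf exists_blkOf_eq)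
open Literature.MathematicalPhysics.QuantumFieldTheory.Balaban1983to89.B4Eq242TorusMirrors
open Literature.MathematicalPhysics.QuantumFieldTheory.Balaban1983to89.B4Eq242TorusMirrorsTiling

variable {d : ℕ} {ℓ Mh k R : ℕ} {P : Fin (d + 1) → ℕ}
variable {F : TDomains d ℓ Mh k P R} {mir : Fin (d + 1) → Bool} {n h : Fin (d + 1) → ℤ}
  {hmir : ∀ μ, mir μ = true → ((N0 ℓ Mh k P) μ : ℤ) = 2 * n μ ∧ 0 ≤ h μ ∧ h μ < n μ ∧ 2 ≤ n μ}

/-! ## §1  The face reflections as permutations of the blocks -/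

section Refl

variable (hblk : ∀ (ε : Fin (d + 1) → Bool) (y y' : ↥(boxDom (N0 ℓ Mh k P))),
  blkOf F.toDomains y = blkOf F.toDomains y' → blkOf F.toDomains (trefl hmir ε y) = blkOf F.toDomains (trefl hmir ε y'))

/-- the block reflection on representatives: `s ↦ y^j(σ_ε x_s)` for a chosen site `x_s` of `s`. [cite: Balaban1984PropagatorsII, (2.45) p.231; Balaban1983RegularityDecay, (2.42) p.584, dictionary] -/
noncomputable def blkReflFun (hmir : ∀ μ, mir μ = true → ((N0 ℓ Mh k P) μ : ℤ) = 2 * n μ ∧ 0 ≤ h μ ∧ h μ < n μ ∧ 2 ≤ n μ) (F : TDomains d ℓ Mh k P R)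
    (ε : Fin (d + 1) → Bool) (s : ↥(bset F.toDomains)) : ↥(bset F.toDomains) :=
  blkOf F.toDomains (trefl hmir ε (Classical.choose (exists_blkOf_eq F.toDomains s)))

include hblk in
/-- the block reflection is well defined: `σ^{blk}_ε (y^j(x)) = y^j(σ_ε x)`. [cite: Balaban1984PropagatorsII, (2.45) p.231; Balaban1983RegularityDecay, (2.42) p.584, bookkeeping] -/
theorem blkReflFun_blkOf (ε : Fin (d + 1) → Bool) (y : ↥(boxDom (N0 ℓ Mh k P))) :
    blkReflFun hmir F ε (blkOf F.toDomains y) = blkOf F.toDomains (trefl hmir ε y) :=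
  hblk ε _ _ (Classical.choose_spec (exists_blkOf_eq F.toDomains (blkOf F.toDomains y)))

include hblk in
/-- the block reflection on representatives is an involution. [cite: Balaban1983RegularityDecay, (2.42) p.584, bookkeeping] -/
theorem blkReflFun_blkReflFun (ε : Fin (d + 1) → Bool) (s : ↥(bset F.toDomains)) : blkReflFun hmir F ε (blkReflFun hmir F ε s) = s := by
  obtain ⟨y, rfl⟩ := exists_blkOf_eq F.toDomains s
  rw [blkReflFun_blkOf hblk, blkReflFun_blkOf hblk, trefl_trefl]

include hblk in
/-- **THE FACE REFLECTION `σ_ε` AS A PERMUTATION OF THE BLOCKS** of a reflection-compatible multilevel family of the doubled torus: `y^j(x) ↦ y^j(σ_ε x)`.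
[cite: Balaban1984PropagatorsII, (2.45) p.231 (the blocks `y`), (2.1) p.224; Balaban1983RegularityDecay, (2.42) p.584] -/
noncomputable def blkRefl (ε : Fin (d + 1) → Bool) : Equiv.Perm ↥(bset F.toDomains) :=
  ⟨blkReflFun hmir F ε, blkReflFun hmir F ε, blkReflFun_blkReflFun hblk ε, blkReflFun_blkReflFun hblk ε⟩

/-- ★ `σ_ε(y^j(x)) = y^j(σ_ε x)`: the block action is compatible with the site action. [cite: Balaban1984PropagatorsII, (2.45) p.231; Balaban1983RegularityDecay, (2.42) p.584] -/
theorem blkRefl_blkOf (ε : Fin (d + 1) → Bool) (y : ↥(boxDom (N0 ℓ Mh k P))) :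
    blkRefl hblk ε (blkOf F.toDomains y) = blkOf F.toDomains (trefl hmir ε y) :=
  blkReflFun_blkOf hblk ε y

/-- the block reflections are multiplicative under the index product. [cite: Balaban1983RegularityDecay, (2.42) p.584, bookkeeping] -/
theorem blkRefl_xorIdx (ε ε' : Fin (d + 1) → Bool) : blkRefl hblk (xorIdx ε ε') = blkRefl hblk ε * blkRefl hblk ε' := by
  ext s : 1
  obtain ⟨y, rfl⟩ := exists_blkOf_eq F.toDomains s
  rw [Equiv.Perm.mul_apply, blkRefl_blkOf, blkRefl_blkOf, blkRefl_blkOf, trefl_xorIdx, Equiv.Perm.mul_apply]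

/-- the trivial multi-index acts trivially on blocks. [cite: Balaban1983RegularityDecay, (2.42) p.584, bookkeeping] -/
theorem blkRefl_bot : blkRefl hblk (hmir := hmir) (fun _ => false) = 1 := by
  ext s : 1
  obtain ⟨y, rfl⟩ := exists_blkOf_eq F.toDomains s
  rw [blkRefl_blkOf, trefl_bot, Equiv.Perm.one_apply, Equiv.Perm.one_apply]

/-- flips compose on blocks as on sites: `σ^{blk}_{flip_μ ε} = σ^{blk}_{δ_μ} σ^{blk}_ε`. [cite: Balaban1983RegularityDecay, (2.42) p.584, bookkeeping] -/
theorem blkRefl_flipAt (μ : Fin (d + 1)) (ε : Fin (d + 1) → Bool) : blkRefl hblk (flipAt μ ε) = blkRefl hblk (hmir := hmir) (single μ) * blkRefl hblk ε := by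
  rw [flipAt_eq_xorIdx, blkRefl_xorIdx]

/-- every block reflection is an involution. [cite: Balaban1983RegularityDecay, (2.42) p.584, bookkeeping] -/
theorem blkRefl_blkRefl (ε : Fin (d + 1) → Bool) (s : ↥(bset F.toDomains)) : blkRefl hblk ε (blkRefl hblk (hmir := hmir) ε s) = s := by
  rw [← Equiv.Perm.mul_apply, ← blkRefl_xorIdx, xorIdx_self, blkRefl_bot, Equiv.Perm.one_apply]

end Refl

/-! ## §2  The blocks inside the open mirror box: freeness, tiling, and the fixed blocks -/

section Inside

/-- **THE BLOCKS INSIDE A SITE SET** (every site whose block is `s` lies in `X`; for `X = Ω₀(□)`: print's blocks `𝔅_□` of the cube sequence inside the Dirichlet domain).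
[cite: Balaban1985BackgroundPropagators, p.409 l.1–5 (the blocks of {Ω_n(□)}), p.394; Balaban1984PropagatorsII, (2.45) p.231, dictionary] -/
noncomputable def blkInside (F : TDomains d ℓ Mh k P R) (X : Finset ↥(boxDom (N0 ℓ Mh k P))) : Finset ↥(bset F.toDomains) :=
  Finset.univ.filter fun s => ∀ y : ↥(boxDom (N0 ℓ Mh k P)), blkOf F.toDomains y = s → y ∈ X

/-- membership in `blkInside`. [cite: Balaban1984PropagatorsII, (2.45) p.231, bookkeeping] -/
theorem mem_blkInside {X : Finset ↥(boxDom (N0 ℓ Mh k P))} {s : ↥(bset F.toDomains)} :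
    s ∈ blkInside F X ↔ ∀ y : ↥(boxDom (N0 ℓ Mh k P)), blkOf F.toDomains y = s → y ∈ X := by
  simp [blkInside]

variable (hblk : ∀ (ε : Fin (d + 1) → Bool) (y y' : ↥(boxDom (N0 ℓ Mh k P))),
  blkOf F.toDomains y = blkOf F.toDomains y' → blkOf F.toDomains (trefl hmir ε y) = blkOf F.toDomains (trefl hmir ε y'))
variable (hmarg : ∀ x ∈ mirBoxOpen (N0 ℓ Mh k P) mir n h, ∀ z : ↥(boxDom (N0 ℓ Mh k P)), blkOf F.toDomains z = blkOf F.toDomains x → z ∈ mirBoxOpen (N0 ℓ Mh k P) mir n h)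

include hmarg in
/-- MARGIN ⇒ the block of a site of the open box is inside it. [cite: Balaban1985BackgroundPropagators, p.408 («Ω₀(□)» a union of blocks of the sequence); Balaban1984PropagatorsII, (2.1) p.224] -/
theorem blkOf_mem_blkInside_of_mem {x : ↥(boxDom (N0 ℓ Mh k P))} (hx : x ∈ mirBoxOpen (N0 ℓ Mh k P) mir n h) :
    blkOf F.toDomains x ∈ blkInside F (mirBoxOpen (N0 ℓ Mh k P) mir n h) :=
  mem_blkInside.2 fun z hz => hmarg x hx z hz

include hblk in
/-- ★ **BLOCK FREENESS**: a non-trivially indexed image of a block inside the open box is not inside it (one of its sites is the image of an open-box site, D2 freeness).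
[cite: Balaban1983RegularityDecay, (2.42) p.584 (the images are distinct, outside the box)] -/
theorem blkRefl_not_mem_blkInside {ε : Fin (d + 1) → Bool} (hε : ε ∈ mirIdx mir) (hne : ε ≠ fun _ => false)
    {s : ↥(bset F.toDomains)} (hs : s ∈ blkInside F (mirBoxOpen (N0 ℓ Mh k P) mir n h)) :
    blkRefl hblk (hmir := hmir) ε s ∉ blkInside F (mirBoxOpen (N0 ℓ Mh k P) mir n h) := by
  obtain ⟨y, rfl⟩ := exists_blkOf_eq F.toDomains s
  have hy : y ∈ mirBoxOpen (N0 ℓ Mh k P) mir n h := mem_blkInside.1 hs y rfl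
  intro hc
  rw [blkRefl_blkOf] at hc
  exact trefl_not_mem_open hmir hε hne hy (mem_blkInside.1 hc (trefl hmir ε y) rfl)

include hblk in
/-- ★ **BLOCK TILING**: two admissible images of blocks inside the open box coincide only trivially. [cite: Balaban1983RegularityDecay, (2.42) p.584] -/
theorem blkRefl_injOn_inside {ε ε' : Fin (d + 1) → Bool} (hε : ε ∈ mirIdx mir) (hε' : ε' ∈ mirIdx mir)
    {s s' : ↥(bset F.toDomains)} (hs : s ∈ blkInside F (mirBoxOpen (N0 ℓ Mh k P) mir n h)) (hs' : s' ∈ blkInside F (mirBoxOpen (N0 ℓ Mh k P) mir n h))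
    (he : blkRefl hblk (hmir := hmir) ε s = blkRefl hblk ε' s') : ε = ε' ∧ s = s' := by
  have hss : s = blkRefl hblk (hmir := hmir) (xorIdx ε ε') s' := by
    have h1 : blkRefl hblk (hmir := hmir) ε (blkRefl hblk ε s) = blkRefl hblk ε (blkRefl hblk ε' s') := by rw [he]
    rw [blkRefl_blkRefl, ← Equiv.Perm.mul_apply, ← blkRefl_xorIdx] at h1
    exact h1
  by_cases hb : xorIdx ε ε' = fun _ => false
  · have hεε : ε = ε' := (xorIdx_eq_bot_iff ε ε').1 hb
    refine ⟨hεε, ?_⟩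
    rw [hss, hb, blkRefl_bot, Equiv.Perm.one_apply]
  · exact absurd (hss ▸ hs) (blkRefl_not_mem_blkInside hblk (xorIdx_mem_mirIdx hε hε') hb hs')

include hblk hmarg in
/-- ★ **A NON-IMAGE BLOCK IS A MIRROR BLOCK**: a block which is not an admissible image of a block inside the open box is fixed by a single mirrored face reflection
(none of its sites is an image of an open-box site — else, by the margin, the source block would be inside —, so any of its sites is a mirror site, and the
reflection fixing that site fixes the block). [cite: Balaban1983RegularityDecay, (2.42) p.584; Balaban1985BackgroundPropagators, p.394 (∂Ω₀); Balaban1984PropagatorsII, (2.45) p.231] -/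
theorem exists_single_fixed_block_of_not_image {b : ↥(bset F.toDomains)}
    (hb : ¬ ∃ ε ∈ mirIdx mir, ∃ s ∈ blkInside F (mirBoxOpen (N0 ℓ Mh k P) mir n h), blkRefl hblk (hmir := hmir) ε s = b) :
    ∃ μ, mir μ = true ∧ blkRefl hblk (hmir := hmir) (single μ) b = b := by
  obtain ⟨y, rfl⟩ := exists_blkOf_eq F.toDomains b
  have hy : ¬ ∃ ε ∈ mirIdx mir, ∃ x ∈ mirBoxOpen (N0 ℓ Mh k P) mir n h, trefl hmir ε x = y := by
    rintro ⟨ε, hε, x, hx, hxy⟩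
    exact hb ⟨ε, hε, blkOf F.toDomains x, blkOf_mem_blkInside_of_mem hmarg hx, by rw [blkRefl_blkOf, hxy]⟩
  obtain ⟨μ, hm, hfix⟩ := exists_single_fixed_of_not_image (hmir := hmir) hy
  exact ⟨μ, hm, by rw [blkRefl_blkOf, hfix]⟩

end Inside

/-! ## §3  Cancellation at the mirror blocks; the engine's block-carrier hypotheses packaged -/

section Cancel

variable {R' : Type*} [CommRing R'] {Y₂ Y₃ : Type*}

/-- ★ **THE MIRROR CANCELLATION AT A FIXED POINT OF ANY CARRIER** (FILE 5b-i's `sum_tsign_mul_eq_zero_of_fixed` with an arbitrary row carrier `Y₂`, action `σ₂`).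
[cite: Balaban1983RegularityDecay, (2.42) p.584; Balaban1985BackgroundPropagators, p.394] -/
theorem sum_tsign_mul_eq_zero_of_fixed₂ (σ₂ : (Fin (d + 1) → Bool) → Equiv.Perm Y₂) (σ₃ : (Fin (d + 1) → Bool) → Equiv.Perm Y₃) {μ : Fin (d + 1)}
    (hμ : mir μ = true) (hσ₃ : ∀ ε ∈ mirIdx mir, σ₃ (flipAt μ ε) = σ₃ (single μ) * σ₃ ε)
    (Nm : Matrix Y₂ Y₃ R') (hN : ∀ u v, Nm (σ₂ (single μ) u) (σ₃ (single μ) v) = Nm u v)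
    {w : Y₂} (hw : σ₂ (single μ) w = w) (y : Y₃) :
    ∑ ε ∈ mirIdx mir, tsign R' mir ε * Nm w (σ₃ ε y) = 0 := by
  refine Finset.sum_involution (fun ε _ => flipAt μ ε) ?_ ?_ ?_ ?_
  · intro ε hε
    have hval : Nm w (σ₃ (flipAt μ ε) y) = Nm w (σ₃ ε y) := by
      rw [hσ₃ ε hε, Equiv.Perm.mul_apply]
      conv_lhs => rw [← hw]
      exact hN w (σ₃ ε y)
    rw [tsign_flipAt hμ, hval, neg_mul, add_neg_cancel]
  · intro ε _ _ heq
    have hc := congrFun heq μ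
    unfold flipAt at hc
    rw [Function.update_self] at hc
    cases h' : ε μ <;> simp [h'] at hc
  · intro ε hε; exact flipAt_mem_mirIdx hμ hε
  · intro ε _; exact flipAt_flipAt μ ε

variable (hblk : ∀ (ε : Fin (d + 1) → Bool) (y y' : ↥(boxDom (N0 ℓ Mh k P))),
  blkOf F.toDomains y = blkOf F.toDomains y' → blkOf F.toDomains (trefl hmir ε y) = blkOf F.toDomains (trefl hmir ε y'))
variable (hmarg : ∀ x ∈ mirBoxOpen (N0 ℓ Mh k P) mir n h, ∀ z : ↥(boxDom (N0 ℓ Mh k P)), blkOf F.toDomains z = blkOf F.toDomains x → z ∈ mirBoxOpen (N0 ℓ Mh k P) mir n h)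

include hblk in
/-- the block action is compatible with the flips (the hypothesis `hσ₃` when `Y₃` = blocks). [cite: Balaban1983RegularityDecay, (2.42) p.584, bookkeeping] -/
theorem blkRefl_flipAt' : ∀ μ, mir μ = true → ∀ ε ∈ mirIdx mir, blkRefl hblk (flipAt μ ε) = blkRefl hblk (hmir := hmir) (single μ) * blkRefl hblk ε :=
  fun μ _ ε _ => blkRefl_flipAt hblk μ ε

include hblk hmarg in
/-- ★★ **CANCELLATION OFF THE IMAGE, block carrier, in the fold engine's shape**: for a kernel `N : blocks × Y₃` jointly invariant under every mirrored face reflection,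
the signed image sum of the row at any block which is not an admissible image of a block inside the open box vanishes.
[cite: Balaban1983RegularityDecay, (2.42) p.584; Balaban1985BackgroundPropagators, p.394, Thm 3.2 p.398] -/
theorem block_cancel (σ₃ : (Fin (d + 1) → Bool) → Equiv.Perm Y₃)
    (hσ₃ : ∀ μ, mir μ = true → ∀ ε ∈ mirIdx mir, σ₃ (flipAt μ ε) = σ₃ (single μ) * σ₃ ε)
    (Nm : Matrix ↥(bset F.toDomains) Y₃ R')
    (hN : ∀ μ, mir μ = true → ∀ u v, Nm (blkRefl hblk (hmir := hmir) (single μ) u) (σ₃ (single μ) v) = Nm u v) :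
    ∀ b : ↥(bset F.toDomains), (¬ ∃ ε ∈ mirIdx mir, ∃ s ∈ blkInside F (mirBoxOpen (N0 ℓ Mh k P) mir n h), blkRefl hblk (hmir := hmir) ε s = b) →
      ∀ y : Y₃, ∑ ε ∈ mirIdx mir, tsign R' mir ε * Nm b (σ₃ ε y) = 0 := by
  intro b hb y
  obtain ⟨μ, hm, hfix⟩ := exists_single_fixed_block_of_not_image hblk hmarg hb
  exact sum_tsign_mul_eq_zero_of_fixed₂ (blkRefl hblk (hmir := hmir)) σ₃ hm (hσ₃ μ hm) Nm (hN μ hm) hfix y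

include hblk in
/-- ★★ **BLOCK TILING, in the fold engine's shape**. [cite: Balaban1983RegularityDecay, (2.42) p.584] -/
theorem block_tiling : ∀ ε ∈ mirIdx mir, ∀ ε' ∈ mirIdx mir, ∀ s ∈ blkInside F (mirBoxOpen (N0 ℓ Mh k P) mir n h), ∀ s' ∈ blkInside F (mirBoxOpen (N0 ℓ Mh k P) mir n h),
    blkRefl hblk (hmir := hmir) ε s = blkRefl hblk ε' s' → ε = ε' ∧ s = s' :=
  fun _ hε _ hε' _ hs _ hs' he => blkRefl_injOn_inside hblk hε hε' hs hs' he

include hblk in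
/-- **BLOCK FREENESS, in the fold engine's shape** (`hfree` of `foldK_one_apply`). [cite: Balaban1983RegularityDecay, (2.42) p.584] -/
theorem block_free : ∀ ε ∈ mirIdx mir, ε ≠ (fun _ => false) → ∀ s ∈ blkInside F (mirBoxOpen (N0 ℓ Mh k P) mir n h),
    blkRefl hblk (hmir := hmir) ε s ∉ blkInside F (mirBoxOpen (N0 ℓ Mh k P) mir n h) :=
  fun _ hε hne _ hs => blkRefl_not_mem_blkInside hblk hε hne hs

include hblk in
/-- **CLOSURE, block carrier, in the fold engine's shape**. [cite: Balaban1983RegularityDecay, (2.42) p.584, bookkeeping] -/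
theorem block_closure :
    (∀ ε ∈ mirIdx mir, ∀ ε' ∈ mirIdx mir, blkRefl hblk (hmir := hmir) (xorIdx ε ε') = blkRefl hblk ε * blkRefl hblk ε') ∧
    blkRefl hblk (hmir := hmir) (fun _ => false) = 1 :=
  ⟨fun ε _ ε' _ => blkRefl_xorIdx hblk ε ε', blkRefl_bot hblk⟩

end Cancel

end Literature.MathematicalPhysics.QuantumFieldTheory.Balaban1983to89.B6MultiLevelTorusMirrorBlockTiling
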